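import Summits.NavierStokesRegularity.NavierStokesRegularity.Theorems.TypeILiouvilleTypeIliouvilleLSupNormSquareBudget
import Summits.NavierStokesRegularity.NavierStokesRegularity.Theorems.TypeILiouvilleTypeIliouvilleLStubOseenConstBoost
import Summits.NavierStokesRegularity.NavierStokesRegularity.Theorems.TypeILiouvilleTypeIliouvilleLOseenGauge
import Summits.NavierStokesRegularity.NavierStokesRegularity.Theorems.TypeILiouvilleTypeIliouvilleLStubTypeIRegimeOfKnssGauge
import Literature.Analysis.FluidPDE.NSBoundedMildSmoothing
import Literature.Analysis.FluidPDE.MildSolution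
import HarnessLib

/-!
# The `L²_t L^∞_x` budget Liouville theorem on the registered stubs of `TypeIliouvilleL`
# (stmt-NavierStokesRegularity-10661): Galilean twin and stub L' by its binders

Helper file (theorems only, no definition, no named fact, no `sorry`; lands
`--supports stmt-NavierStokesRegularity-10661`), companion of
`TypeILiouvilleTypeIliouvilleLSupNormSquareBudget` (`SupSqBudget.oseenMild_eq_zero`: a mild bounded
ancient field of print's class with `‖v(t)‖_∞ ≤ g(t)`, `∫_{t<T} g² < ∞`, vanishes).

* `SupSqBudget.oseenMild_const` — the Galilean twin: in print's class WITH weakly divergence-free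
  slices, `‖v(t,·) − b‖_∞ ≤ g(t)` on `t < T` with `∫ g² < ∞` for ONE constant `b` forces `v ≡ b`
  (constant boost `stub_oseen_const_boost` + the main theorem); on this sub-class the conclusions
  of stubs S3ᵐ (`stub_persistent_mild_backward_L3_recurrence`) and L_Q (`stub_quiescentLiouville`)
  hold with all `b_k = b`.
* `SupSqBudget.knssGauge_eq_zero` — stub L' (`stub_typeIAncientLiouville_knssGauge` = stmt-4050)
  BY ITS BINDERS on the budget class: a field of the KNSS-gauge Type-I class with a
  square-integrable sup-norm majorant on some past slab vanishes (time shift `τ ↦ τ + t/2` to a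
  bounded slab, `heatFlow_of_pos`, `oseenDuhamel_translate`, main theorem).  The Type-I majorant
  `C/√(−t)` is itself NOT square integrable (`SupSqBudget.not_integrableOn_typeIRate_sq`): the
  open core of L' is exactly the logarithmically divergent endpoint.

* `SupSqBudget.crux_conclusion_of_sqIntegrable_aeBound` — **(L) ITSELF on the budget class of the
  CRUX'S OWN duality-form class**: a bounded ancient mild solution `u`
  (`IsBoundedAncientMildSolution 1 u`, a.e.-strongly measurable slices — the binders of
  `TypeIliouvilleL` verbatim) with `‖u(t)‖_{L^∞} ≤ g(t)` (a.e. in space) for `t < T` and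
  `∫_{t<T} g² < ∞` is a.e. constant on EVERY slice `t < 0` (the conclusion of `TypeIliouvilleL`
  verbatim).  Route: Oseen gauge theorem `oseen_gauge_of_aestronglyMeasurable`
  (`u(t) = v(t, · − A t) + c(t)` a.e.), conservation of momentum
  (`stub_oseen_ball_average_momentum`) gives `‖c(t) − c(s)‖ ≤ g(t) + g(s)`, the parasitic drift
  `c` converges backward along times where `g → 0` (which exist, `g²` being integrable on a
  half-line) to `c_∞` with `‖c(t) − c_∞‖ ≤ g(t)`, so `‖v(t) + c_∞‖_∞ ≤ 2g(t)` and the Galilean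
  twin gives `v ≡ −c_∞`, `u(t) = c(t) − c_∞` a.e.: the parasitic solutions `b(t)` of KNSS 2009 §1
  with `b ∈ L²(−∞,T)` are the only members of the budget class.

* (append) `SupSqBudget.floor_hypothesis_of_sqIntegrable_supBound` — RECORD OF INCLUSION: the budget
  stratum lies inside stratum 0 of the tree's self-similar FLOOR
  (`TypeILiouvilleSelfSimilarFloor.const_of_backward_small_rate`, lim inf √(−t)·sup‖v − c‖ < ε₀ ⟹ v ≡ c):
  a square-integrable majorant dips below `ε₀/√(−t)` at arbitrarily far times.  So the main theorem
  of `…SupNormSquareBudget` is, for weakly divergence-free fields, a corollary of the floor; new there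
  are the elementary proof (no KNSS local smoothing, no divergence constraint) and the sharpness lemma.

WHAT THIS IS NOT: not L', not S3ᵐ, not (L); nothing about Navier–Stokes regularity. [folklore]
-/

set_option linter.dupNamespace false

noncomputable section

namespace Summit.NavierStokesRegularity.NavierStokesRegularity.Theorems.SupSqBudget

open MeasureTheory Set Filter Function
open scoped ENNReal NNReal Topology
open Literature.Analysis Literature.Analysis.FluidPDE

/-! ### Galilean twin: budget against one uniform stream -/

/-- **`L²_t L^∞_x` convergence budget to ONE uniform stream forces the stream.** In print's class
(continuous, uniformly bounded, weakly divergence-free slices, Oseen-mild on `(−∞,0) × ℝ³`), if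
for one constant vector `b`, one majorant `g` and one `T` one has `‖v(t,x) − b‖ ≤ g(t)` for
`t < T` with `∫_{t<T} g² < ∞`, then `v ≡ b`: the constant Galilean boost
`w(t,y) = v(t, y + t•b) − b` (`stub_oseen_const_boost`) is in the class with the same majorant,
and `oseenMild_eq_zero` kills it.  (On this sub-class the conclusions of stubs S3ᵐ and L_Q hold
with `b_k = b`.) [cite: KochNadirashviliSereginSverak2009, §4 p. 8 (arXiv:0709.3599)] -/
theorem oseenMild_const
    (v : ℝ → EuclideanSpace ℝ (Fin 3) → EuclideanSpace ℝ (Fin 3)) (b : EuclideanSpace ℝ (Fin 3))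
    (hvc : ContinuousOn (uncurry v) (Iio 0 ×ˢ univ))
    (hvK : ∃ K : ℝ, ∀ t < 0, ∀ x, ‖v t x‖ ≤ K)
    (hvd : ∀ t < 0, IsWeaklyDivFree (v t))
    (hvm : ∀ s t : ℝ, s < t → t < 0 → ∀ x,
      v t x = UnboundedOperators.heatExtension (v s) (t - s) x - oseenDuhamel 1 s v v t x)
    {g : ℝ → ℝ} {T : ℝ} (hg : ∀ t < T, ∀ x, ‖v t x - b‖ ≤ g t)
    (hint : IntegrableOn (fun t => g t ^ 2) (Iio T)) :
    ∀ t < 0, ∀ x, v t x = b := by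
  obtain ⟨hwc, hwK, -, hwm⟩ := stub_oseen_const_boost v b hvc hvK hvd hvm
  have hw := oseenMild_eq_zero (fun t y => v t (y + t • b) - b) hwc hwK hwm
    (g := g) (T := T) (fun t ht y => hg t ht (y + t • b)) hint
  intro t ht x
  have h := hw t ht (x - t • b)
  simp only [sub_add_cancel] at h
  exact sub_eq_zero.1 h

/-! ### Stub L' (Type-I regime, KNSS gauge) on the budget class -/

/-- **Stub L' by its binders, on the `L²_t L^∞_x` budget class.** A field `u` of the class of
`stub_typeIAncientLiouville_knssGauge` (= stmt-4050: jointly smooth on `(−∞,0) × ℝ³`,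
divergence-free slices, the Oseen integral equation written with `heatFlow`/`oseenKernel`, Type-I
time decay `‖u(t,x)‖ ≤ C/√(−t)`) which moreover has a square-integrable sup-norm majorant on some
past slab (`‖u(t,x)‖ ≤ g(t)` for `t < T`, `∫_{t<T} g² < ∞`) vanishes identically.  Proof: for
`t < 0` the time shift `v(τ) = u(τ + t/2)` is bounded (by `C/√(−t/2)`), continuous and Oseen-mild
on `(−∞,0)` (`heatFlow_of_pos`, `oseenDuhamel_translate`) with the shifted majorant, so
`oseenMild_eq_zero` gives `v ≡ 0`, i.e. `u(t) = v(t/2) = 0`.  The Type-I majorant itself is NOT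
square integrable (`not_integrableOn_typeIRate_sq`): what remains of L' is exactly the
logarithmically divergent endpoint. [cite: KochNadirashviliSereginSverak2009, §4 p. 8 (arXiv:0709.3599)] -/
theorem knssGauge_eq_zero (C : ℝ) (u : ℝ → EuclideanSpace ℝ (Fin 3) → EuclideanSpace ℝ (Fin 3))
    (hu : ContDiffOn ℝ (⊤ : ℕ∞) (Function.uncurry u) (Set.Iio 0 ×ˢ Set.univ) ∧
      (∀ t < 0, Literature.Analysis.FluidPDE.VectorCalculus.IsDivFree (u t)) ∧
      (∀ s t : ℝ, s < t → t < 0 → ∀ x,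
        u t x = Literature.Analysis.FluidPDE.heatFlow (u s) (t - s) x -
          ∫ τ in Set.Ioo s t, ∫ y,
            Literature.Analysis.FluidPDE.oseenKernel (t - τ) (x - y) (u τ y) (u τ y)) ∧
      Literature.Analysis.FluidPDE.HasTypeITimeDecay C u)
    {g : ℝ → ℝ} {T : ℝ} (hg : ∀ t < T, ∀ x, ‖u t x‖ ≤ g t)
    (hint : IntegrableOn (fun t => g t ^ 2) (Iio T)) :
    ∀ t < 0, ∀ x, u t x = 0 := by
  obtain ⟨hsmooth, -, hmild, hTI⟩ := hu
  have hC0 : 0 ≤ C := by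
    have h := hTI (-1) (by norm_num) 0
    rw [neg_neg, Real.sqrt_one, div_one] at h
    exact (norm_nonneg _).trans h
  have hcont : ContinuousOn (uncurry u) (Iio 0 ×ˢ univ) := hsmooth.continuousOn
  intro t ht x
  -- the shift `c = t/2 < 0`
  set c : ℝ := t / 2 with hcdef
  have hc : c < 0 := by rw [hcdef]; linarith
  set v : ℝ → EuclideanSpace ℝ (Fin 3) → EuclideanSpace ℝ (Fin 3) := fun τ => u (τ + c) with hvdef
  -- continuity
  have hvc : ContinuousOn (uncurry v) (Iio 0 ×ˢ univ) := by
    have hmap : MapsTo (fun p : ℝ × EuclideanSpace ℝ (Fin 3) => (p.1 + c, p.2))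
        (Iio 0 ×ˢ univ) (Iio 0 ×ˢ univ) := by
      intro p hp
      exact ⟨by have := hp.1; simp only [mem_Iio] at this ⊢; linarith, mem_univ _⟩
    have hsh : Continuous (fun p : ℝ × EuclideanSpace ℝ (Fin 3) => (p.1 + c, p.2)) := by fun_prop
    exact hcont.comp hsh.continuousOn hmap
  -- boundedness
  have hvK : ∃ K : ℝ, ∀ τ < 0, ∀ y, ‖v τ y‖ ≤ K := by
    refine ⟨C / Real.sqrt (-c), fun τ hτ y => ?_⟩
    have hτc : τ + c < 0 := by linarith
    have h1 : ‖u (τ + c) y‖ ≤ C / Real.sqrt (-(τ + c)) := hTI (τ + c) hτc y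
    have h2 : Real.sqrt (-c) ≤ Real.sqrt (-(τ + c)) := Real.sqrt_le_sqrt (by linarith)
    have h3 : 0 < Real.sqrt (-c) := Real.sqrt_pos.2 (by linarith)
    exact h1.trans (div_le_div_of_nonneg_left hC0 h3 h2)
  -- the Oseen identity in print's notation
  have hvm : ∀ s' t' : ℝ, s' < t' → t' < 0 → ∀ y,
      v t' y = UnboundedOperators.heatExtension (v s') (t' - s') y - oseenDuhamel 1 s' v v t' y := by
    intro s' t' hs't' ht' y
    have h := hmild (s' + c) (t' + c) (by linarith) (by linarith) y
    have hts : t' + c - (s' + c) = t' - s' := by ring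
    rw [hts, heatFlow_of_pos _ (sub_pos.2 hs't')] at h
    have hB : (∫ τ in Set.Ioo (s' + c) (t' + c), ∫ z,
        Literature.Analysis.FluidPDE.oseenKernel (t' + c - τ) (y - z) (u τ z) (u τ z)) =
        oseenDuhamel 1 (s' + c) u u (t' + c) y := by
      simp only [oseenDuhamel_apply, one_mul]
    rw [hB, ← oseenDuhamel_translate 1 s' c u u t' y] at h
    exact h
  -- the shifted majorant
  have hg' : ∀ τ < T - c, ∀ y, ‖v τ y‖ ≤ g (τ + c) := fun τ hτ y => hg (τ + c) (by linarith) y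
  have hint' : IntegrableOn (fun τ => g (τ + c) ^ 2) (Iio (T - c)) := by
    have h := ((measurePreserving_add_right (volume : Measure ℝ) c).integrableOn_comp_preimage
      (measurableEmbedding_addRight c) (f := fun t => g t ^ 2) (s := Iio T)).2 hint
    simpa only [Function.comp_def, preimage_add_const_Iio] using h
  have hz := oseenMild_eq_zero v hvc hvK hvm (g := fun τ => g (τ + c)) (T := T - c) hg' hint'
  have h := hz (t - c) (by rw [hcdef]; linarith) x
  simpa only [hvdef, sub_add_cancel] using h

/-! ### (L) itself on the budget class of the crux's duality-form class -/

open TypeIliouvilleL.TypeIRegimeOfKnssGauge in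
/-- **The conclusion of `TypeIliouvilleL` ((L), KNSS Liouville conjecture) for members of its own
class with a finite `L²_t L^∞_x` budget.** Let `u` be a bounded ancient mild solution of
Navier–Stokes in the duality form (`IsBoundedAncientMildSolution 1 u`) with a.e.-strongly
measurable slices — the binders of the crux verbatim — and suppose `‖u(t, x)‖ ≤ g(t)` for a.e. `x`,
every `t < T`, with `∫_{t<T} g(t)² dt < ∞`.  Then every slice `u(t)`, `t < 0`, is a.e. constant —
the conclusion of the crux verbatim.  Proof: the Oseen gauge theorem writes
`u(t) = v(t, · − A(t)) + c(t)` a.e. with `v` in print's class; an a.e. bound of a continuous field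
holds everywhere, so `‖v(t) + c(t)‖ ≤ g(t)` pointwise (`t < min T 0`); conservation of momentum at
spatial infinity (`stub_oseen_ball_average_momentum`) gives `‖c(t) − c(s)‖ ≤ g(t) + g(s)`; along
times `s_n < −n` with `g(s_n) ≤ 1/(n+1)` (`exists_lt_and_le_of_integrableOn_sq`) the drift `c(s_n)`
is Cauchy with limit `c_∞`, `‖c(t) − c_∞‖ ≤ g(t)`; hence `‖v(t) − (−c_∞)‖ ≤ 2g(t)` and the
Galilean twin `oseenMild_const` gives `v ≡ −c_∞`, i.e. `u(t) = c(t) − c_∞` a.e.  (So the members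
of the crux's class with finite endpoint budget are exactly KNSS's parasitic solutions `b(t)`,
`b ∈ L²(−∞,T)`, for which (L) holds trivially.) [cite: KochNadirashviliSereginSverak2009, §1 p. 3 (parasitic solutions b(t), conjecture (L)) and §4 p. 8 (arXiv:0709.3599)] -/
theorem crux_conclusion_of_sqIntegrable_aeBound
    (u : ℝ → EuclideanSpace ℝ (Fin 3) → EuclideanSpace ℝ (Fin 3))
    (hu : Literature.Analysis.FluidPDE.IsBoundedAncientMildSolution 1 u)
    (hmeas : ∀ t < 0, AEStronglyMeasurable (u t) volume)
    {g : ℝ → ℝ} {T : ℝ}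
    (hg : ∀ t < T, ∀ᵐ x ∂(volume : Measure (EuclideanSpace ℝ (Fin 3))), ‖u t x‖ ≤ g t)
    (hint : IntegrableOn (fun t => g t ^ 2) (Iio T)) :
    ∀ t < 0, ∃ b : EuclideanSpace ℝ (Fin 3), u t =ᵐ[volume] fun _ => b := by
  obtain ⟨v, A, c, hvm, hvc, ⟨K, hK⟩, hvd, hvmild, -, hrep⟩ :=
    oseen_gauge_of_aestronglyMeasurable u hu hmeas
  set T' : ℝ := min T 0 with hT'def
  have hT'T : T' ≤ T := min_le_left _ _
  have hT'0 : T' ≤ 0 := min_le_right _ _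
  -- slices of `v` are continuous
  have hvsl : ∀ t < 0, Continuous (v t) := fun t ht =>
    hvc.comp_continuous (Continuous.prodMk_right t) fun y => ⟨ht, mem_univ y⟩
  -- Step 1: `‖v(t) + c(t)‖ ≤ g(t)` everywhere, `t < T'`
  have h1 : ∀ t < T', ∀ y, ‖v t y + c t‖ ≤ g t := fun t ht y =>
    norm_add_le_of_ae_rep (hvsl t (lt_of_lt_of_le ht hT'0)) (hrep t (lt_of_lt_of_le ht hT'0))
      (hg t (lt_of_lt_of_le ht hT'T)) y
  -- Step 2: momentum, `‖c(t) − c(s)‖ ≤ g(t) + g(s)` for `s < t < T'`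
  have h2 : ∀ s t : ℝ, s < t → t < T' → ‖c t - c s‖ ≤ g t + g s := by
    intro s t hst ht
    have ht0 : t < 0 := lt_of_lt_of_le ht hT'0
    have hs : s < T' := hst.trans ht
    have hmom := stub_oseen_ball_average_momentum v K s t hst hvm
      (fun σ hσ y => hK σ (hσ.2.trans_lt ht0) y)
    have hid : ∀ y, Literature.Analysis.UnboundedOperators.heatExtension (v s) (t - s) y - v s y -
        oseenDuhamel 1 s v v t y = v t y - v s y := by
      intro y
      rw [hvmild s t hst ht0 y]
      abel
    have hmom' : Tendsto (fun R : ℝ => ⨍ y in Metric.ball (0 : EuclideanSpace ℝ (Fin 3)) R,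
        (v t y - v s y)) atTop (𝓝 0) := by
      refine hmom.congr fun R => ?_
      simp only [hid]
    exact norm_sub_le_add_of_tendsto_setAverage (hvsl t ht0) (hvsl s (lt_of_lt_of_le hs hT'0))
      (h1 t ht) (h1 s hs) hmom'
  have h2' : ∀ s t : ℝ, s < T' → t < T' → ‖c t - c s‖ ≤ g t + g s := by
    intro s t hs ht
    rcases lt_trichotomy s t with hst | rfl | hts
    · exact h2 s t hst ht
    · have : 0 ≤ g s := (norm_nonneg _).trans (h1 s hs 0)
      rw [sub_self, norm_zero]; linarith
    · rw [norm_sub_rev, add_comm]; exact h2 t s hts hs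
  -- Step 3: far times with small majorant, and the backward limit of the drift
  have hsmall : ∀ n : ℕ, ∃ s, s < min T' (-(n : ℝ)) ∧ g s ≤ 1 / ((n : ℝ) + 1) := fun n =>
    exists_lt_and_le_of_integrableOn_sq hint ((min_le_left _ _).trans hT'T) (by positivity)
  choose s hs using hsmall
  have hsT' : ∀ n, s n < T' := fun n => lt_of_lt_of_le (hs n).1 (min_le_left _ _)
  have hsn : ∀ n, s n < -(n : ℝ) := fun n => lt_of_lt_of_le (hs n).1 (min_le_right _ _)
  have hb0 : Tendsto (fun n : ℕ => 1 / ((n : ℝ) + 1)) atTop (𝓝 0) :=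
    tendsto_one_div_add_atTop_nhds_zero_nat
  have hdist : ∀ n m : ℕ, n ≤ m → dist (c (s n)) (c (s m)) ≤ 2 * (1 / ((n : ℝ) + 1)) := by
    intro n m hnm
    rw [dist_eq_norm, norm_sub_rev]
    have hle : (1 : ℝ) / ((m : ℝ) + 1) ≤ 1 / ((n : ℝ) + 1) := by
      have : (n : ℝ) ≤ m := by exact_mod_cast hnm
      exact one_div_le_one_div_of_le (by positivity) (by linarith)
    calc ‖c (s m) - c (s n)‖ ≤ g (s m) + g (s n) := h2' (s n) (s m) (hsT' n) (hsT' m)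
      _ ≤ 1 / ((m : ℝ) + 1) + 1 / ((n : ℝ) + 1) := add_le_add (hs m).2 (hs n).2
      _ ≤ 2 * (1 / ((n : ℝ) + 1)) := by linarith
  have hb2 : Tendsto (fun n : ℕ => 2 * (1 / ((n : ℝ) + 1))) atTop (𝓝 0) := by
    simpa using hb0.const_mul 2
  have hcauchy : CauchySeq fun n : ℕ => c (s n) :=
    cauchySeq_of_le_tendsto_0' (fun n : ℕ => 2 * (1 / ((n : ℝ) + 1))) hdist hb2
  obtain ⟨cinf, hcinf⟩ := cauchySeq_tendsto_of_complete hcauchy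
  have h3 : ∀ t < T', ‖c t - cinf‖ ≤ g t := by
    intro t ht
    have hlim1 : Tendsto (fun m : ℕ => ‖c t - c (s m)‖) atTop (𝓝 ‖c t - cinf‖) :=
      (tendsto_const_nhds.sub hcinf).norm
    have hlim2 : Tendsto (fun m : ℕ => g t + 1 / ((m : ℝ) + 1)) atTop (𝓝 (g t)) := by
      simpa using hb0.const_add (g t)
    refine le_of_tendsto_of_tendsto hlim1 hlim2 (Eventually.of_forall fun m => ?_)
    exact (h2' (s m) t (hsT' m) ht).trans (add_le_add le_rfl (hs m).2)
  -- Step 4: `‖v(t) − (−c_∞)‖ ≤ 2 g(t)` on `t < T'`, and the Galilean twin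
  have h4 : ∀ t < T', ∀ y, ‖v t y - (-cinf)‖ ≤ 2 * g t := by
    intro t ht y
    calc ‖v t y - (-cinf)‖ = ‖(v t y + c t) - (c t - cinf)‖ := by congr 1; abel
      _ ≤ ‖v t y + c t‖ + ‖c t - cinf‖ := norm_sub_le _ _
      _ ≤ g t + g t := add_le_add (h1 t ht y) (h3 t ht)
      _ = 2 * g t := by ring
  have hint' : IntegrableOn (fun t => (2 * g t) ^ 2) (Iio T') := by
    have h : IntegrableOn (fun t => 4 * g t ^ 2) (Iio T') :=
      (hint.mono_set (Iio_subset_Iio hT'T)).const_mul 4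
    refine h.congr_fun (fun t _ => ?_) measurableSet_Iio
    show 4 * g t ^ 2 = (2 * g t) ^ 2
    ring
  have hv : ∀ t < 0, ∀ y, v t y = -cinf :=
    oseenMild_const v (-cinf) hvc ⟨K, hK⟩ hvd hvmild (g := fun t => 2 * g t) (T := T') h4 hint'
  -- Step 5: the slice is a.e. the constant `c(t) − c_∞`
  intro t₀ ht₀
  have hfun : (fun x => v t₀ (x - A t₀) + c t₀) = fun _ => c t₀ - cinf := by
    funext x
    rw [hv t₀ ht₀]
    abel
  refine ⟨c t₀ - cinf, ?_⟩
  rw [← hfun]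
  exact hrep t₀ ht₀

/-! ### The budget stratum sits inside the self-similar FLOOR's stratum 0 (record of the inclusion) -/

/-- **A square-integrable majorant dips below the self-similar clock at arbitrarily far times.** If
`∫_{t<T} g² < ∞` then for every `ε > 0` and every `T'` there is a time `s < min T (min T' 0)` with
`√(−s) · g(s) ≤ ε` — otherwise `g(t)² > ε²/(−t)` on a whole past slab, whose integral diverges
(`not_integrableOn_typeIRate_sq`). [folklore] -/
theorem exists_lt_sqrt_mul_le_of_integrableOn_sq {g : ℝ → ℝ} {T : ℝ}
    (hint : IntegrableOn (fun t => g t ^ 2) (Iio T)) {ε : ℝ} (hε : 0 < ε) (T' : ℝ) :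
    ∃ s, s < min T (min T' 0) ∧ Real.sqrt (-s) * g s ≤ ε := by
  by_contra h
  push Not at h
  set a : ℝ := min T (min T' 0) with ha
  have ha0 : a ≤ 0 := (min_le_right _ _).trans (min_le_right _ _)
  have haT : a ≤ T := min_le_left _ _
  have hint' : IntegrableOn (fun t => g t ^ 2) (Iio a) := hint.mono_set (Iio_subset_Iio haT)
  -- on `t < a ≤ 0` the clock `(ε/√(−t))²` is dominated by `g²`
  have hdom : ∀ t ∈ Iio a, (ε / Real.sqrt (-t)) ^ 2 ≤ g t ^ 2 := by
    intro t ht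
    have ht0 : 0 < -t := by have := lt_of_lt_of_le ht ha0; linarith
    have hs : 0 < Real.sqrt (-t) := Real.sqrt_pos.2 ht0
    have h1 : ε / Real.sqrt (-t) < g t := by
      rw [div_lt_iff₀ hs, mul_comm]; exact h t ht
    have h2 : 0 ≤ ε / Real.sqrt (-t) := by positivity
    nlinarith
  have hcont : ContinuousOn (fun t : ℝ => (ε / Real.sqrt (-t)) ^ 2) (Iio a) := by
    refine ContinuousOn.pow (continuousOn_const.div ?_ fun t ht => ?_) 2
    · exact (Real.continuous_sqrt.comp continuous_neg).continuousOn
    · have ht0 : 0 < -t := by have := lt_of_lt_of_le ht ha0; linarith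
      exact (Real.sqrt_pos.2 ht0).ne'
  have hclock : IntegrableOn (fun t : ℝ => (ε / Real.sqrt (-t)) ^ 2) (Iio a) := by
    refine Integrable.mono' hint' (hcont.aestronglyMeasurable measurableSet_Iio) ?_
    filter_upwards [ae_restrict_mem measurableSet_Iio] with t ht
    rw [Real.norm_of_nonneg (sq_nonneg _)]
    exact hdom t ht
  exact not_integrableOn_typeIRate_sq hε.ne' ha0 hclock

/-- **The `L²_t L^∞_x` budget stratum lies inside stratum 0 of the self-similar FLOOR.** Under the
hypotheses of `oseenMild_eq_zero` (a majorant `g` of `‖v(t)‖_∞` on `t < T` with `∫_{t<T} g² < ∞`)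
the field satisfies, for every `ε₀ > 0`, the hypothesis of the tree's floor theorem
`TypeILiouvilleSelfSimilarFloor.const_of_backward_small_rate` with the stream `c = 0`: for every
`T' < 0` there is `s < T'` with `√(−s)‖v(s,x) − 0‖ ≤ ε₀` for all `x`.  Hence, for weakly
divergence-free fields, `oseenMild_eq_zero` is a COROLLARY of that floor (KNSS Prop. 4.1 local
smoothing + uniqueness); what `…SupNormSquareBudget` adds is an elementary proof (bilinear sup bound
only: no local smoothing, no divergence constraint) and the sharpness lemma at the Type-I rate.  The
floor's module is deliberately not imported here (its import closure contains two further route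
cones); this lemma records the inclusion in the floor's hypothesis shape. [folklore] -/
theorem floor_hypothesis_of_sqIntegrable_supBound
    {v : ℝ → EuclideanSpace ℝ (Fin 3) → EuclideanSpace ℝ (Fin 3)} {g : ℝ → ℝ} {T : ℝ}
    (hg : ∀ t < T, ∀ x, ‖v t x‖ ≤ g t) (hint : IntegrableOn (fun t => g t ^ 2) (Iio T))
    {ε₀ : ℝ} (hε₀ : 0 < ε₀) :
    ∀ T' : ℝ, T' < 0 → ∃ s : ℝ, s < T' ∧
      ∀ x, Real.sqrt (-s) * ‖v s x - 0‖ ≤ ε₀ := by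
  intro T' _
  obtain ⟨s, hs, hsg⟩ := exists_lt_sqrt_mul_le_of_integrableOn_sq hint hε₀ T'
  have hsT : s < T := lt_of_lt_of_le hs (min_le_left _ _)
  have hsT' : s < T' := lt_of_lt_of_le hs ((min_le_right _ _).trans (min_le_left _ _))
  refine ⟨s, hsT', fun x => ?_⟩
  rw [sub_zero]
  exact (mul_le_mul_of_nonneg_left (hg s hsT x) (Real.sqrt_nonneg _)).trans hsg

end Summit.NavierStokesRegularity.NavierStokesRegularity.Theorems.SupSqBudget

end
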